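/- Copyright: the b2b-balaban cell (near-miss cell 7), T⁴-continuum fan-out; row NE7b ROUND-2 swarm, seat
t4-ne7b-formalise-leaf-08 (gen 13) (leaf-08's smallness-census lane F-leaf08g8-1 ∕ S12m ∕ S12q: «THE INFRARED FACTOR
DISPLAYED» = row S12r, file 3∕3 — the window END with BOTH factors in closed form; INTENT journal l.20193, owner GO
R-OWNER-24-3 l.20269).  Released under the licence of the surrounding project. -/
import Summits.QuantumFields.BalabanUV.T4Continuum.Support.HistoryAssemblyRealiseRunMultPPayRoot
import Summits.QuantumFields.BalabanUV.T4Continuum.Support.HistoryRealiseCellsRunWindowT3bPc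

/-!
# Realised histories: THE PINNED END AT THE CONCAVE CONSTANT, THE COUPLING WINDOW IN CLOSED FORM IN BOTH FACTORS

Summits-side support leaf of the T⁴-continuum cell (rung (B)+1 on a FINITE torus only; NOT infinite volume, NOT the
mass gap, NOT the Clay statement; NOT a proof of the spine estimate NE7b).  Claim table
`t4/b2b-balaban-t4-ne7b-p1/LEAVES-NE7b.md`, leaf-08's smallness-census lane (F-leaf08g8-1 ∕ rows S12m, S12q): row S12r
«THE INFRARED FACTOR DISPLAYED» (owner GO R-OWNER-24-3, journal l.20269), file 3∕3 (files 1–2: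
`HistoryAssemblyTreesPayRoot`, `HistoryAssemblyRealiseRunMultPPayRoot` — the window's END chain re-plugged at the explicit
threshold, each theorem the tree's verbatim with one binder re-lettered).

WHY.  Row S12q (`HistoryRealiseCellsRunWindowT3bPc.hybridNE7_of_realisedDomainsRun_windowT3bPDc`, p232166) DISPLAYED the
coupling window of the pinned END as `W = min (min 1 e^{−irThresholdTLE∕2}) (e^{−(x_root+1)∕2})`: the second factor a
closed form (the census's «0.31» at `p₀ = 23`, numerals p230007 ∕ p233003), the FIRST factor over the NAMED threshold
`HistoryExitLE.irThresholdTLE := Classical.choose …`, of which no size is derivable in the kernel in either direction.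
The census wording of record (owner (11q), journal l.19799; leaf-01 gen 11 l.19771, leaf-10 gen 15 §9, leaf-09 gen 12
`HistoryWindowNumerals` §6) sizes the first factor on the one road where the threshold is EXPLICIT — leaf-08 gen 8's
`HistoryPayThresholdRoot.payThresholdRoot` (p225123; every root clause a floor BY NAME, v1.1 p232877 §4: at the witness
letters the merger clause gives `x_pay ≥ 13·(14·E₂∕A₀)^{1∕11}`, first factor `≤ 1.5·10⁻³` once `E₂ ≥ A₀∕14` —
journal-only numbers, c6) — a road on which no END, hence no window theorem, ran.  This file closes that gap: the same
window statement with the EXPLICIT threshold in the first factor, proved through the re-plugged chain.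

WHAT.  **`hybridNE7_of_realisedDomainsRun_windowT3bPDcPayRoot`** — p232166's statement with the single token
`irThresholdTLE ↦ payThresholdRoot` inside the displayed window; proof = p232166's road (flow side ⇐ `BetaPertHyp`, (B)
side from the pin, root level by `HistoryFlowProfileRoot.thresholdPaid_of_coupling_root`, twin bound PRODUCED by
`htwin_concave`, `hdis` DISCHARGED by `hdisV_of_domainsR`, slot multiplicity by `card_koccOf_le_exp_of_twin` — the steps
of `…MultEndPDTwin` ∕ `…MultEndPTwin` composed inline) into file 2's socket
`hybridNE7_of_realisedDomainsRun_printedMultPPayRoot`.  §2 `example`s: (F1) under the displayed window the coupling sits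
below the MERGER-CLAUSE factor `e^{−x₄∕2}` BY NAME (p232877's `exp_neg_payThresholdRoot_half_le_merger`) — the shape of
the census number; (F2) and below `e^{−1∕2}` (`one_le_payThresholdRoot`) — the first factor is a genuine smallness
condition on every road.

HONEST READING (c4).  A re-plumbing of OUR window END over OUR explicit threshold: `HybridNE7` for the string's term
families ⇐ (B) ∧ BetaPertHyp ∧ [γ small (∃), g ≤ W_pay (displayed, closed form)] ∧ H3 (realised pedigrees with domains,
`step ≤ cutoff`, `DisjointJoins` ∕ `BoxedBirths`, realised costs, price sentences with the discount, numerator readings)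
∧ E1∕E2-type integral bounds ∧ the (B)-side floors ∕ sites ∕ envelopes ∧ NE7c's `ShellWeightBound` ∧ NE7's
`ReindexedBudget` ∧ four summable rates — all DISPLAYED as before, none in print, none a theorem of the tree.  p232166,
the pinned END p224056, END v3.1′ p223694 and the HEADLINE OF RECORD p224237 are UNCHANGED BY NAME and not superseded
(the named and the explicit thresholds are incomparable in the kernel; this is a SECOND displayed window, neither
implies the other; the headline's Prop hides every window under `ForSmallCouplings` and does not move).  [folklore]
composition by name; no `def`, no `structure`, no `Prop`-fact minted (c1), no `[cite:]` tag, nothing printed asserted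
(ABSOLUTE RULE), no constant specialised (c2∕c6), no exit ∕ socket ∕ `HistoryConstants*` ∕ landed file touched (c3).
NE7b NOT proved; spine 0∕9.  HONEST DEPENDENCY (cell): continuum YM on T⁴ ⇐ BetaPertH ∧ nine spine estimates (0/9
proved); BetaPertH ⇐ (D1) ∧ (D4) ∧ CAP+tail; G-an2-4 gates asym, D1 and NE2/3/4.  This file changes none of it. -/

open Finset MeasureTheory
open Literature.MathematicalPhysics.QuantumFieldTheory.Balaban1983to89
open T4PersistenceDictionary T4PersistentHistoryCount T4BankedInduction T4PrintedShapeBanking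
open T4WeightBudget T4GlobalDenominator T4LiveClassFibration T4LiveStructureGas T4LiveGasToTerms T4RecordPriceSeam
open T4PartnerMultiplicity T4IndicatorShell T4MatchingAssembly T4MatchingClosure T4MatchingClosureSocket T4Continuum
open T4StabilitySocket T4BranchingRecordsGas T4TaggedShapeBanking T4CanonicalMenus T4RenewalChains
open Summit.QuantumFields.BalabanUV.T4Continuum.PlacementBatch Summit.QuantumFields.BalabanUV.T4Continuum.PlacementSkeleton
open Summit.QuantumFields.BalabanUV.T4Continuum.CountThresholdUniform Summit.QuantumFields.BalabanUV.T4Continuum.CountThresholdExit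
open Summit.QuantumFields.BalabanUV.T4Continuum.CountSeamJunction Summit.QuantumFields.BalabanUV.T4Continuum.LateMergers
open Summit.QuantumFields.BalabanUV.T4Continuum.HistoryFlow Summit.QuantumFields.BalabanUV.T4Continuum.HistoryRegeneration
open Summit.QuantumFields.BalabanUV.T4Continuum.HistoryTables Summit.QuantumFields.BalabanUV.T4Continuum.HistoryAssemblyTrees
open Summit.QuantumFields.BalabanUV.T4Continuum.HistoryAssemblyTerms Summit.QuantumFields.BalabanUV.T4Continuum.HistoryAssemblyPedigree
open Summit.QuantumFields.BalabanUV.T4Continuum.HistoryConstants Summit.QuantumFields.BalabanUV.T4Continuum.HistoryGen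
open Literature.MathematicalPhysics.QuantumFieldTheory.Balaban1983to89.B13ScaleTransfer
open Summit.QuantumFields.BalabanUV.T4Continuum.ZoneSkeleton Summit.QuantumFields.BalabanUV.T4Continuum.HistorySocketTH
open Summit.QuantumFields.BalabanUV.T4Continuum.HistoryCaps Summit.QuantumFields.BalabanUV.T4Continuum.HistoryAssemblyPrice
open Summit.QuantumFields.BalabanUV.T4Continuum.HistoryBankingLE Summit.QuantumFields.BalabanUV.T4Continuum.HistoryExitLE
open Summit.QuantumFields.BalabanUV.T4Continuum.HistoryAssemblyTreesLE Summit.QuantumFields.BalabanUV.T4Continuum.HistoryAssemblyTermsLE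
open Summit.QuantumFields.BalabanUV.T4Continuum.HistoryRealise Summit.QuantumFields.BalabanUV.T4Continuum.HistoryAssemblyRealiseLE
open Summit.QuantumFields.BalabanUV.T4Continuum.HistoryAssemblyMult Summit.QuantumFields.BalabanUV.T4Continuum.HistoryAssemblyMultKey
open Summit.QuantumFields.BalabanUV.T4Continuum.HistoryAssemblyRealiseRun Summit.QuantumFields.BalabanUV.T4Continuum.HistoryAssemblyRealiseMult
open Summit.QuantumFields.BalabanUV.T4Continuum.HistoryZones Summit.QuantumFields.BalabanUV.T4Continuum.HistoryRealiseCells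
open Summit.QuantumFields.BalabanUV.T4Continuum.HistoryRealiseCellsRun Summit.QuantumFields.BalabanUV.T4Continuum.HistoryAssemblyRealiseRunMult
open Summit.QuantumFields.BalabanUV.T4Continuum.HistoryRealiseCellsRunMult Summit.QuantumFields.BalabanUV.T4Continuum.HistoryAssemblyMultInstance
open Summit.QuantumFields.BalabanUV.T4Continuum.HistoryJoinsPlacedMember Summit.QuantumFields.BalabanUV.T4Continuum.PlacementSkeleton
open Summit.QuantumFields.BalabanUV.T4Continuum.HistoryJoinsPlacedMult Summit.QuantumFields.BalabanUV.T4Continuum.HistoryRealiseDistinct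
open Summit.QuantumFields.BalabanUV.T4Continuum.HistoryRegionTemplates Summit.QuantumFields.BalabanUV.T4Continuum.HistoryCaps
open Summit.QuantumFields.BalabanUV.T4Continuum.HistoryZoneEvolve (cth)
open Literature.MathematicalPhysics.QuantumFieldTheory.Balaban1983to89.B16SProfile (DropCtl)
open Summit.QuantumFields.BalabanUV.T4Continuum.HistoryRealiseCellsRunMultEnd Summit.QuantumFields.BalabanUV.T4Continuum.HistoryRealiseCellsRunMultP
open Summit.QuantumFields.BalabanUV.T4Continuum.HistoryRealiseCellsRunMultEndP
open Summit.QuantumFields.BalabanUV.T4Continuum.HistoryRealiseCellsRunMultEndPD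
open Summit.QuantumFields.BalabanUV.T4Continuum.HistoryRealiseCellsRunMultEndPTwin
open Summit.QuantumFields.BalabanUV.T4Continuum.HistoryRealiseCellsRunMultEndPDTwin

-- letters of the twin bound (as opened in `HistoryAssemblyMultInstance`)
open Finset
open Literature.MathematicalPhysics.QuantumFieldTheory.Balaban1983to89.B13ScaleTransfer (Pt FaceConnected)
open T4PersistenceDictionary T4PrintedShapeBanking T4TaggedShapeBanking T4PartnerMultiplicity T4BranchingRecordsGas
open Summit.QuantumFields.BalabanUV.T4Continuum.ZoneTorus
open Summit.QuantumFields.BalabanUV.T4Continuum.HistoryAdmissible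
open Summit.QuantumFields.BalabanUV.T4Continuum.HistoryJoins
open Summit.QuantumFields.BalabanUV.T4Continuum.HistoryJoinsAdm
open Summit.QuantumFields.BalabanUV.T4Continuum.HistoryAssemblyMultLetters
open Summit.QuantumFields.BalabanUV.T4Continuum.HistoryJoinsTemplates
open Summit.QuantumFields.BalabanUV.T4Continuum.HistoryJoinsPlacedZone
open Summit.QuantumFields.BalabanUV.T4Continuum.HistoryJoinsPlacedValue
open Summit.QuantumFields.BalabanUV.T4Continuum.HistoryJoinsPlacedTwin
open Summit.QuantumFields.BalabanUV.T4Continuum.HistorySiblingEntropyBridge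
open Summit.QuantumFields.BalabanUV.T4Continuum.HistoryZoneMassLawLevels
open Summit.QuantumFields.BalabanUV.T4Continuum.HistoryRenewalsCost

open Summit.QuantumFields.BalabanUV.T4Continuum.HistoryAssemblyMultInstanceConcave (htwin_concave)
open Summit.QuantumFields.BalabanUV.T4Continuum.HistoryAssemblyMultInstanceTwin (card_koccOf_le_exp_of_twin)
open Summit.QuantumFields.BalabanUV.T4Continuum.HistoryPayThresholdRoot
open Summit.QuantumFields.BalabanUV.T4Continuum.HistoryAssemblyTreesPayRoot
open Summit.QuantumFields.BalabanUV.T4Continuum.HistoryAssemblyRealiseRunMultPPayRoot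

namespace Summit.QuantumFields.BalabanUV.T4Continuum.HistoryRealiseCellsRunWindowT3bPcPayRoot

noncomputable section

universe u v w

section Pinned

variable {F : T4Family} {G : Type*} [GaugeGroup G] [MeasurableSpace G] [HaarData G] [RegularGaugeGroup G]

/-- **NE7b's COUNT EXIT — THE PINNED END AT THE CONCAVE CONSTANT, THE COUPLING WINDOW DISPLAYED IN CLOSED FORM IN
BOTH FACTORS (explicit pay-threshold road).**  Row S12q's
`HistoryRealiseCellsRunWindowT3bPc.hybridNE7_of_realisedDomainsRun_windowT3bPDc` (p232166) VERBATIM except ONE token of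
the displayed window: its first factor `exp (−irThresholdTLE C F.L rr β₀ ∕ 2)` (the NAMED `Classical.choose` threshold —
sizeless in the kernel) becomes **`exp (−HistoryPayThresholdRoot.payThresholdRoot C F.L rr β₀ ∕ 2)`** (leaf-08 gen 8's
EXPLICIT threshold p225123: the max of seven root clauses of the symbolic constants; its floors BY NAME in p232877 §4).
So the hypothesis reads `∀ g, 0 < g → g ≤ min (min 1 e^{−payThresholdRoot∕2}) (e^{−(x_root + 1)∕2}) → …` with BOTH
factors closed forms of `(C, F.L, rr, β₀, d, sS, θc, θ)`; every other binder and the conclusion token for token.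
Proof: S12q's (flow side from `BetaPertHyp`, (B) side from the pin, the level at the ROOT by
`HistoryFlowProfileRoot.thresholdPaid_of_coupling_root`, the twin bound PRODUCED by `htwin_concave`, `hdis` DISCHARGED by
`hdisV_of_domainsR`, the slot multiplicity by `card_koccOf_le_exp_of_twin`) ending in file 2's socket
`hybridNE7_of_realisedDomainsRun_printedMultPPayRoot` — the END chain at the explicit threshold.  A SECOND displayed
window beside p232166 (the two thresholds are incomparable in the kernel: neither statement implies the other); the
pinned END p224056, END v3.1′ p223694 and the headline of record p224237 are untouched.  NE7b NOT proved. [folklore] -/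
theorem hybridNE7_of_realisedDomainsRun_windowT3bPDcPayRoot (D : FiniteEpsData F G)
    -- the two pins, BY NAME, and the sign conventions of the datum
    (hB : B16.EndStatementBPrinted D.C) (hβ : BetaPertHyp D.βfun) (hsign : B16.SignConventions D.C)
    -- the constants (symbolic, c2∕c6) and their side conditions; NO `Dominates` on the slack road
    {C : T4PrintedShapeBanking.Consts} {O : PrintedO1s}
    {rr : ℕ} {β₀ : ℝ} (h : ThresholdOK C F.L rr β₀) (hμ : 0 < C.μ) (d n : ℕ)
    (hκ₁ : (d : ℝ) * Real.log F.L + 2 * Real.log 2 ≤ C.κ₁) (hE₀ : Real.log (2 + birthMass C) ≤ C.E₀)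
    (hA₀ : 1 ≤ C.A₀) (hβ₀ : 0 < β₀) (hLβ : (F.L : ℝ) * β₀ ≤ 1) (hn₁ : 13 ≤ C.n₁) (hn : 0 < n)
    -- the class-linear slack for ANY POSITIVE `θ` (the level `P` with `hθJ : ΘJc + … ≤ θ·P` and the profile clause `hP`
    -- are DISCHARGED on the DISPLAYED window), and row S6g′'s letters: stride `sS`, decay `θc`, arithmetic, signs
    {θ : ℝ} (hθ : 0 < θ) (hslack : C.a + θ ≤ O.γ₀ * O.A₁ ^ 2 / 2)
    (hE₂ : 0 < C.E₂) (hE₃ : 0 ≤ C.E₃) {sS : ℕ} (hsS : 1 ≤ sS)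
    (hsmall : (((2 * cth 32 1 sS + 1) ^ d : ℕ) : ℝ) * (5 : ℝ) ^ d * ((max 1 (2 * 32 + 2) : ℕ) : ℝ) ≤
      (F.L : ℝ) ^ (sS / 2) / 2)
    {θc : ℝ} (hθc0 : 0 ≤ θc) (hθc1 : θc < 1) (hθcs : 1 / 2 ≤ θc ^ sS) :
    ∃ γ₁ : ℝ, 0 < γ₁ ∧ ∀ γ : ℝ, 0 < γ → γ ≤ γ₁ → ∀ g : ℝ, 0 < g →
      -- THE COUPLING WINDOW, DISPLAYED: the EXPLICIT (root) pay threshold, and the ROOT level of the concave constant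
      g ≤ min (min 1 (Real.exp (-(payThresholdRoot C F.L rr β₀) / 2)))
        (Real.exp (-((max 1 ((((1 + Real.log
            ((2 * (((2 * cth 32 1 sS + 1) ^ d : ℕ) : ℝ) * ((((2 * 32 + 1) ^ d : ℕ) : ℝ) * (4 * 2 ^ d)) +
                  4 * ((((2 * cth 32 1 sS + 1) ^ d : ℕ) : ℝ) * (5 : ℝ) ^ d)) / (1 - θc) +
              2 * (2 * ((((2 * cth 32 1 sS + 1) ^ d : ℕ) : ℝ) * (5 : ℝ) ^ d))) +
            (0 + 3 * (2 * Real.log (2 * d + 1)) + 2 * (d : ℝ) + 2 * Real.log (2 * d + 1) * (4 * 2 ^ d) +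
              (d : ℝ) * Real.log (2 *
                ((((max 1 (2 * 32 + 2) : ℕ) : ℝ) *
                      ((2 * (((2 * cth 32 1 sS + 1) ^ d : ℕ) : ℝ) * ((((2 * 32 + 1) ^ d : ℕ) : ℝ) * (4 * 2 ^ d)) +
                          4 * ((((2 * cth 32 1 sS + 1) ^ d : ℕ) : ℝ) * (5 : ℝ) ^ d)) / (1 - θc)) +
                    ((max 1 (2 * 32 + 2) : ℕ) : ℝ) * (2 * ((((2 * cth 32 1 sS + 1) ^ d : ℕ) : ℝ) * (5 : ℝ) ^ d)) + 1) *
                  (1 + 4 * 2 ^ d)) + 1)) +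
            10) + 8 * 2 ^ d * Real.log (2 * d + 1)) / (θ * C.A₀)) ^ ((C.p₀ : ℝ)⁻¹)) + 1) / 2))) →
      ∃ Em : ℝ, 0 ≤ Em ∧ ∀ g₀ : ℕ → ℝ, D.Tuned γ g g₀ →
      ∀ {ι : Type u} [DecidableEq ι] {α : Type v} {π : Type w} [DecidableEq α] [DecidableEq π]
        (l₀ vol : ℝ) (K₀ : ℕ) (T : ℕ → Finset ι) (A A' shA shB dead dead' : ℕ → ℝ → ι → ℝ)
        (nup mup : ℕ → ℝ → ℝ) (Nup : ℝ) (Cc Rr CcRec RrRec : ℕ → ℝ → ι → ℝ) (ν u s₂ q₀ r s Wsh : ℕ → ℝ)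
        -- the observable and the two runs' (α) integral bounds, floors, site budgets, envelopes ((B) side, displayed)
        (obs : (K : ℕ) → GaugeField (F.P K) 0 G → ℝ) (B : ℝ),
        (∀ K, Measurable (obs K)) →
        (∀ K U, |obs K U| ≤ B) →
        (∀ K t, |t| ≤ l₀ → K₀ ≤ K →
          ∫ U, Real.exp (t * obs K U) * D.dens K (g₀ K) 0 U ∂fieldMeasure (F.P K) 0 G ≤ ∑ τ ∈ T K, A K t τ) →
        (∀ K t, |t| ≤ l₀ → K₀ ≤ K →
          ∫ U, Real.exp (t * obs (K + 1) U) * D.dens (K + 1) (g₀ (K + 1)) 0 U ∂fieldMeasure (F.P (K + 1)) 0 G ≤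
          ∑ τ ∈ T K, A' K t τ) →
      ∀ (c₀ n₁ : ℝ),
        0 < c₀ →
        (∀ K, K₀ ≤ K → c₀ ≤ smallFieldMass D K (g₀ K)) →
        (∀ K, K₀ ≤ K → c₀ ≤ smallFieldMass D (K + 1) (g₀ (K + 1))) →
        (∀ K, K₀ ≤ K → ((D.C ⟨K, F.m, g₀ K⟩).numSites K : ℝ) ≤ n₁) →
        (∀ K, K₀ ≤ K → ((D.C ⟨K + 1, F.m, g₀ (K + 1)⟩).numSites (K + 1) : ℝ) ≤ n₁) →
        0 ≤ Nup →
        (∀ K t, |t| ≤ l₀ → K₀ ≤ K → 0 ≤ nup K t ∧ nup K t ≤ Nup) →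
        (∀ K t, |t| ≤ l₀ → K₀ ≤ K → 0 ≤ mup K t ∧ mup K t ≤ Nup) →
      -- the (2.5) side condition on the size function
      ∀ (R : ℕ → ℕ → ℕ),
        (∀ K s, s ≤ K → B14.IsRj F.L rr ((D.C ⟨K, F.m, g₀ K⟩).flow.g s) (R K s)) →
        (∀ K, K₀ ≤ K → ∀ t, 1 ≤ R K t) →
      -- H3: the terms read as pedigrees REALISED BY THE RUN'S OWN PROFILE with their DOMAINS
      ∀ (ped : ℕ → ι → Pedigree α π) (cellP : ℕ → ι → π → Pt d × Finset (Pt d)) (liveC : ℕ → ι → Finset α) (Zd : ℕ → ι → α → Finset (Pt d)),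
        RealisedDomainsR F.L (runProfile F.L R) n K₀ R T ped cellP liveC Zd →
      -- H3: live components dated no later than the cutoff; the constituents' reading clauses
        (∀ K, K₀ ≤ K → ∀ τ ∈ T K, ∀ c ∈ liveC K τ, (ped K τ).step c ≤ K) →
        (∀ K, K₀ ≤ K → ∀ τ ∈ T K, ∀ c ∈ liveC K τ, DisjointJoins ((ped K τ).toPGen (cellP K τ) c)) →
        (∀ K, K₀ ≤ K → ∀ τ ∈ T K, ∀ c ∈ liveC K τ,
          BoxedBirths n F.L K (levelOf (runProfile F.L R K) K) ((ped K τ).toPGen (cellP K τ) c)) →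
      -- H3: realised per-step costs of the live members, read below the model's booked cost
      ∀ (κ κ' : ℕ → (Fin d → ℕ) × Gen (Lab α π) → Gen (Lab α π) → ℕ → ℝ),
        (∀ K, K₀ ≤ K → ∀ τ ∈ badTerms (memOf ped liveC (cellOfR n F.L (runProfile F.L R) ped cellP)) jhalf T K, ∀ q ∈ memOf ped liveC (cellOfR n F.L (runProfile F.L R) ped cellP) K τ,
          ∀ m ∈ life (padW (dictWT Prod.fst (R K) C.n₁) 0) q.2,
          κ K q q.2 m ≤ costT Prod.fst C K (R K) q.2 m) →
        (∀ K, K₀ ≤ K → ∀ τ ∈ badTerms (memOf ped liveC (cellOfR n F.L (runProfile F.L R) ped cellP)) jhalf T K, ∀ q ∈ memOf ped liveC (cellOfR n F.L (runProfile F.L R) ped cellP) K τ,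
          ∀ m ∈ life (padW (dictWT Prod.fst (R K) C.n₁) 0) q.2,
          κ' K q q.2 m ≤ costT Prod.fst C K (R K) q.2 m) →
      -- H3: the per-term price sentence over the named members in PRINT's currency, discounted; both runs
      ∀ (FcM RfM FcM' RfM' : ℕ → Finset ((Fin d → ℕ) × Gen PEv × Multiset (PEv × ((Fin d → ℕ) × Finset (Pt d)))) → ℝ),
        (∀ K t, |t| ≤ l₀ → K₀ ≤ K → ∀ τ ∈ badTerms (memOf ped liveC (cellOfR n F.L (runProfile F.L R) ped cellP)) jhalf T K,
          FcM K (kmemOf ped liveC (cellOfR n F.L (runProfile F.L R) ped cellP) (physV n F.L hn (Nat.lt_of_lt_of_le Nat.zero_lt_two (two_le_L F))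
          (fun K => tcap d (dcapOf Prod.fst T (memOf ped liveC (cellOfR n F.L (runProfile F.L R) ped cellP)) K))
          (fun K => one_le_tcap d (dcapOf Prod.fst T (memOf ped liveC (cellOfR n F.L (runProfile F.L R) ped cellP)) K)) (runProfile F.L R) ped cellP) K τ) * RfM K (kmemOf ped liveC (cellOfR n F.L (runProfile F.L R) ped cellP) (physV n F.L hn (Nat.lt_of_lt_of_le Nat.zero_lt_two (two_le_L F))
          (fun K => tcap d (dcapOf Prod.fst T (memOf ped liveC (cellOfR n F.L (runProfile F.L R) ped cellP)) K))
          (fun K => one_le_tcap d (dcapOf Prod.fst T (memOf ped liveC (cellOfR n F.L (runProfile F.L R) ped cellP)) K)) (runProfile F.L R) ped cellP) K τ) ≤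
          ∏ q ∈ memOf ped liveC (cellOfR n F.L (runProfile F.L R) ped cellP) K τ,
          pshapeTH Prod.fst O C 1 1 (R K) (D.C ⟨K, F.m, g₀ K⟩).flow.g 0 (κ K q) q.2 * Real.exp (-(8 / C.E₂ * totalCostT Prod.fst C K (R K) q.2 + 4 * (partnerAges (PEv.step ∘ Prod.fst) q.2 : ℝ)))) →
        (∀ K t, |t| ≤ l₀ → K₀ ≤ K → ∀ τ ∈ badTerms (memOf ped liveC (cellOfR n F.L (runProfile F.L R) ped cellP)) jhalf T K,
          FcM' K (kmemOf ped liveC (cellOfR n F.L (runProfile F.L R) ped cellP) (physV n F.L hn (Nat.lt_of_lt_of_le Nat.zero_lt_two (two_le_L F))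
          (fun K => tcap d (dcapOf Prod.fst T (memOf ped liveC (cellOfR n F.L (runProfile F.L R) ped cellP)) K))
          (fun K => one_le_tcap d (dcapOf Prod.fst T (memOf ped liveC (cellOfR n F.L (runProfile F.L R) ped cellP)) K)) (runProfile F.L R) ped cellP) K τ) * RfM' K (kmemOf ped liveC (cellOfR n F.L (runProfile F.L R) ped cellP) (physV n F.L hn (Nat.lt_of_lt_of_le Nat.zero_lt_two (two_le_L F))
          (fun K => tcap d (dcapOf Prod.fst T (memOf ped liveC (cellOfR n F.L (runProfile F.L R) ped cellP)) K))
          (fun K => one_le_tcap d (dcapOf Prod.fst T (memOf ped liveC (cellOfR n F.L (runProfile F.L R) ped cellP)) K)) (runProfile F.L R) ped cellP) K τ) ≤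
          ∏ q ∈ memOf ped liveC (cellOfR n F.L (runProfile F.L R) ped cellP) K τ,
          pshapeTH Prod.fst O C 1 1 (R K) (D.C ⟨K, F.m, g₀ K⟩).flow.g 0 (κ' K q) q.2 * Real.exp (-(8 / C.E₂ * totalCostT Prod.fst C K (R K) q.2 + 4 * (partnerAges (PEv.step ∘ Prod.fst) q.2 : ℝ)))) →
      -- H3: the remaining `Regeneration` numerator readings, over the PHYSICAL member families (run A, then run B)
        (∀ K t, |t| ≤ l₀ → K₀ ≤ K →
          ∀ k ∈ badGMems (memOf ped liveC (cellOfR n F.L (runProfile F.L R) ped cellP)) jhalf T (kmemOf ped liveC (cellOfR n F.L (runProfile F.L R) ped cellP) (physV n F.L hn (Nat.lt_of_lt_of_le Nat.zero_lt_two (two_le_L F))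
          (fun K => tcap d (dcapOf Prod.fst T (memOf ped liveC (cellOfR n F.L (runProfile F.L R) ped cellP)) K))
          (fun K => one_le_tcap d (dcapOf Prod.fst T (memOf ped liveC (cellOfR n F.L (runProfile F.L R) ped cellP)) K)) (runProfile F.L R) ped cellP)) K,
          ∀ τ ∈ fibre (kmemOf ped liveC (cellOfR n F.L (runProfile F.L R) ped cellP) (physV n F.L hn (Nat.lt_of_lt_of_le Nat.zero_lt_two (two_le_L F))
          (fun K => tcap d (dcapOf Prod.fst T (memOf ped liveC (cellOfR n F.L (runProfile F.L R) ped cellP)) K))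
          (fun K => one_le_tcap d (dcapOf Prod.fst T (memOf ped liveC (cellOfR n F.L (runProfile F.L R) ped cellP)) K)) (runProfile F.L R) ped cellP)) T K k, A K t τ ≤ dead K t τ * FcM K k * nup K t) →
        (∀ K t, |t| ≤ l₀ → K₀ ≤ K →
          ∀ k ∈ badGMems (memOf ped liveC (cellOfR n F.L (runProfile F.L R) ped cellP)) jhalf T (kmemOf ped liveC (cellOfR n F.L (runProfile F.L R) ped cellP) (physV n F.L hn (Nat.lt_of_lt_of_le Nat.zero_lt_two (two_le_L F))
          (fun K => tcap d (dcapOf Prod.fst T (memOf ped liveC (cellOfR n F.L (runProfile F.L R) ped cellP)) K))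
          (fun K => one_le_tcap d (dcapOf Prod.fst T (memOf ped liveC (cellOfR n F.L (runProfile F.L R) ped cellP)) K)) (runProfile F.L R) ped cellP)) K,
          ∀ τ ∈ fibre (kmemOf ped liveC (cellOfR n F.L (runProfile F.L R) ped cellP) (physV n F.L hn (Nat.lt_of_lt_of_le Nat.zero_lt_two (two_le_L F))
          (fun K => tcap d (dcapOf Prod.fst T (memOf ped liveC (cellOfR n F.L (runProfile F.L R) ped cellP)) K))
          (fun K => one_le_tcap d (dcapOf Prod.fst T (memOf ped liveC (cellOfR n F.L (runProfile F.L R) ped cellP)) K)) (runProfile F.L R) ped cellP)) T K k, 0 ≤ dead K t τ) →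
        (∀ K t, |t| ≤ l₀ → K₀ ≤ K →
          ∀ k ∈ badGMems (memOf ped liveC (cellOfR n F.L (runProfile F.L R) ped cellP)) jhalf T (kmemOf ped liveC (cellOfR n F.L (runProfile F.L R) ped cellP) (physV n F.L hn (Nat.lt_of_lt_of_le Nat.zero_lt_two (two_le_L F))
          (fun K => tcap d (dcapOf Prod.fst T (memOf ped liveC (cellOfR n F.L (runProfile F.L R) ped cellP)) K))
          (fun K => one_le_tcap d (dcapOf Prod.fst T (memOf ped liveC (cellOfR n F.L (runProfile F.L R) ped cellP)) K)) (runProfile F.L R) ped cellP)) K,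
          ∑ τ ∈ fibre (kmemOf ped liveC (cellOfR n F.L (runProfile F.L R) ped cellP) (physV n F.L hn (Nat.lt_of_lt_of_le Nat.zero_lt_two (two_le_L F))
          (fun K => tcap d (dcapOf Prod.fst T (memOf ped liveC (cellOfR n F.L (runProfile F.L R) ped cellP)) K))
          (fun K => one_le_tcap d (dcapOf Prod.fst T (memOf ped liveC (cellOfR n F.L (runProfile F.L R) ped cellP)) K)) (runProfile F.L R) ped cellP)) T K k, dead K t τ ≤ RfM K k) →
        (∀ K t, |t| ≤ l₀ → K₀ ≤ K →
          ∀ k ∈ badGMems (memOf ped liveC (cellOfR n F.L (runProfile F.L R) ped cellP)) jhalf T (kmemOf ped liveC (cellOfR n F.L (runProfile F.L R) ped cellP) (physV n F.L hn (Nat.lt_of_lt_of_le Nat.zero_lt_two (two_le_L F))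
          (fun K => tcap d (dcapOf Prod.fst T (memOf ped liveC (cellOfR n F.L (runProfile F.L R) ped cellP)) K))
          (fun K => one_le_tcap d (dcapOf Prod.fst T (memOf ped liveC (cellOfR n F.L (runProfile F.L R) ped cellP)) K)) (runProfile F.L R) ped cellP)) K, 0 ≤ FcM K k) →
        (∀ K t, |t| ≤ l₀ → K₀ ≤ K →
          ∀ k ∈ badGMems (memOf ped liveC (cellOfR n F.L (runProfile F.L R) ped cellP)) jhalf T (kmemOf ped liveC (cellOfR n F.L (runProfile F.L R) ped cellP) (physV n F.L hn (Nat.lt_of_lt_of_le Nat.zero_lt_two (two_le_L F))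
          (fun K => tcap d (dcapOf Prod.fst T (memOf ped liveC (cellOfR n F.L (runProfile F.L R) ped cellP)) K))
          (fun K => one_le_tcap d (dcapOf Prod.fst T (memOf ped liveC (cellOfR n F.L (runProfile F.L R) ped cellP)) K)) (runProfile F.L R) ped cellP)) K,
          ∀ τ ∈ fibre (kmemOf ped liveC (cellOfR n F.L (runProfile F.L R) ped cellP) (physV n F.L hn (Nat.lt_of_lt_of_le Nat.zero_lt_two (two_le_L F))
          (fun K => tcap d (dcapOf Prod.fst T (memOf ped liveC (cellOfR n F.L (runProfile F.L R) ped cellP)) K))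
          (fun K => one_le_tcap d (dcapOf Prod.fst T (memOf ped liveC (cellOfR n F.L (runProfile F.L R) ped cellP)) K)) (runProfile F.L R) ped cellP)) T K k, A' K t τ ≤ dead' K t τ * FcM' K k * mup K t) →
        (∀ K t, |t| ≤ l₀ → K₀ ≤ K →
          ∀ k ∈ badGMems (memOf ped liveC (cellOfR n F.L (runProfile F.L R) ped cellP)) jhalf T (kmemOf ped liveC (cellOfR n F.L (runProfile F.L R) ped cellP) (physV n F.L hn (Nat.lt_of_lt_of_le Nat.zero_lt_two (two_le_L F))
          (fun K => tcap d (dcapOf Prod.fst T (memOf ped liveC (cellOfR n F.L (runProfile F.L R) ped cellP)) K))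
          (fun K => one_le_tcap d (dcapOf Prod.fst T (memOf ped liveC (cellOfR n F.L (runProfile F.L R) ped cellP)) K)) (runProfile F.L R) ped cellP)) K,
          ∀ τ ∈ fibre (kmemOf ped liveC (cellOfR n F.L (runProfile F.L R) ped cellP) (physV n F.L hn (Nat.lt_of_lt_of_le Nat.zero_lt_two (two_le_L F))
          (fun K => tcap d (dcapOf Prod.fst T (memOf ped liveC (cellOfR n F.L (runProfile F.L R) ped cellP)) K))
          (fun K => one_le_tcap d (dcapOf Prod.fst T (memOf ped liveC (cellOfR n F.L (runProfile F.L R) ped cellP)) K)) (runProfile F.L R) ped cellP)) T K k, 0 ≤ dead' K t τ) →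
        (∀ K t, |t| ≤ l₀ → K₀ ≤ K →
          ∀ k ∈ badGMems (memOf ped liveC (cellOfR n F.L (runProfile F.L R) ped cellP)) jhalf T (kmemOf ped liveC (cellOfR n F.L (runProfile F.L R) ped cellP) (physV n F.L hn (Nat.lt_of_lt_of_le Nat.zero_lt_two (two_le_L F))
          (fun K => tcap d (dcapOf Prod.fst T (memOf ped liveC (cellOfR n F.L (runProfile F.L R) ped cellP)) K))
          (fun K => one_le_tcap d (dcapOf Prod.fst T (memOf ped liveC (cellOfR n F.L (runProfile F.L R) ped cellP)) K)) (runProfile F.L R) ped cellP)) K,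
          ∑ τ ∈ fibre (kmemOf ped liveC (cellOfR n F.L (runProfile F.L R) ped cellP) (physV n F.L hn (Nat.lt_of_lt_of_le Nat.zero_lt_two (two_le_L F))
          (fun K => tcap d (dcapOf Prod.fst T (memOf ped liveC (cellOfR n F.L (runProfile F.L R) ped cellP)) K))
          (fun K => one_le_tcap d (dcapOf Prod.fst T (memOf ped liveC (cellOfR n F.L (runProfile F.L R) ped cellP)) K)) (runProfile F.L R) ped cellP)) T K k, dead' K t τ ≤ RfM' K k) →
        (∀ K t, |t| ≤ l₀ → K₀ ≤ K →
          ∀ k ∈ badGMems (memOf ped liveC (cellOfR n F.L (runProfile F.L R) ped cellP)) jhalf T (kmemOf ped liveC (cellOfR n F.L (runProfile F.L R) ped cellP) (physV n F.L hn (Nat.lt_of_lt_of_le Nat.zero_lt_two (two_le_L F))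
          (fun K => tcap d (dcapOf Prod.fst T (memOf ped liveC (cellOfR n F.L (runProfile F.L R) ped cellP)) K))
          (fun K => one_le_tcap d (dcapOf Prod.fst T (memOf ped liveC (cellOfR n F.L (runProfile F.L R) ped cellP)) K)) (runProfile F.L R) ped cellP)) K, 0 ≤ FcM' K k) →
      -- the seam's other inputs: NE7c's shell weight bound, NE7's core budget, four summable rates
        ShellWeightBound l₀ T A A' shA shB Wsh →
        ReindexedBudget l₀ vol T (fun K t τ => A K t τ - shA K t τ) (fun K t τ => A' K t τ - shB K t τ)
          (badOfClass (bstrOf Prod.fst (memOf ped liveC (cellOfR n F.L (runProfile F.L R) ped cellP))) T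
          (fun K _ => badClasses Prod.fst (memOf ped liveC (cellOfR n F.L (runProfile F.L R) ped cellP)) jhalf T K)) Cc Rr CcRec RrRec ν u s₂ q₀ r s →
        Summable r →
        Summable u →
        Summable s →
        Summable s₂ →
    ∃ K₁ K₂, K₀ ≤ K₁ ∧ HybridNE7 l₀ vol (fun K => T (K₁ + (K₂ + K))) (fun K => A (K₁ + (K₂ + K)))
      (fun K => A' (K₁ + (K₂ + K)))
      (fun K => badOfClass (bstrOf Prod.fst (memOf ped liveC (cellOfR n F.L (runProfile F.L R) ped cellP))) T
        (fun K _ => badClasses Prod.fst (memOf ped liveC (cellOfR n F.L (runProfile F.L R) ped cellP)) jhalf T K) (K₁ + (K₂ + K)))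
      (fun K => constOf l₀ B Em n₁ c₀ Nup *
        recordsBudget (birthMass C) C.κ₁ ((n : ℝ) ^ d) ((F.L : ℝ) ^ d) (Real.log 2) jhalf (K₁ + (K₂ + K)))
      (fun K => shA (K₁ + (K₂ + K))) (fun K => shB (K₁ + (K₂ + K))) (fun K => Wsh (K₁ + (K₂ + K)))
      (fun K => (r (K₁ + (K₂ + K)) + u (K₁ + (K₂ + K))) + (s (K₁ + (K₂ + K)) + s₂ (K₁ + (K₂ + K)))) := by
  -- thresholds: the flow side from `BetaPertHyp`, the (B) side from the pin; the window is DISPLAYED (no `g₁` chosen)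
  obtain ⟨hβ₁, hβhalf⟩ := HistoryRealiseCellsRunPinned.beta0_le_of_L_mul_le (F := F) hLβ
  obtain ⟨γ₀, b, β', _hγ₀, hb, _hbβ, hlo, hhi, γf, hγf, hγf₀, hS⟩ :=
    flowSide_of_betaPertHyp D hβ hβ₀ hβ₁ hLβ (max C.p₀ rr)
  obtain ⟨γB, hγB, em, ep, hcor⟩ := hB.2
  refine ⟨min γf γB, lt_min hγf hγB, fun γ hγ hγle g hg hgle => ⟨max (em g) 0, le_max_right _ _, fun g₀ ht => ?_⟩⟩
  obtain ⟨hSm, hγβ⟩ := hS γ hγ (hγle.trans (min_le_left _ _))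
  have hγ₀le : γ ≤ γ₀ := hγle.trans ((min_le_left _ _).trans hγf₀)
  -- the class-linear constant `Θ := ΘJc + 8·2^d·log(2d+1)` (row S12o (ii)'s concave constant + the root-template slope),
  -- paid at the ROOT level `P := C.A₀·x^{C.p₀}`, `x := max 1 ((Θ ∕ (θ·C.A₀))^{1∕p₀})` (leaf-08 gen 8)
  let Θ : ℝ := (1 + Real.log
            ((2 * (((2 * cth 32 1 sS + 1) ^ d : ℕ) : ℝ) * ((((2 * 32 + 1) ^ d : ℕ) : ℝ) * (4 * 2 ^ d)) +
                  4 * ((((2 * cth 32 1 sS + 1) ^ d : ℕ) : ℝ) * (5 : ℝ) ^ d)) / (1 - θc) +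
              2 * (2 * ((((2 * cth 32 1 sS + 1) ^ d : ℕ) : ℝ) * (5 : ℝ) ^ d))) +
            (0 + 3 * (2 * Real.log (2 * d + 1)) + 2 * (d : ℝ) + 2 * Real.log (2 * d + 1) * (4 * 2 ^ d) +
              (d : ℝ) * Real.log (2 *
                ((((max 1 (2 * 32 + 2) : ℕ) : ℝ) *
                      ((2 * (((2 * cth 32 1 sS + 1) ^ d : ℕ) : ℝ) * ((((2 * 32 + 1) ^ d : ℕ) : ℝ) * (4 * 2 ^ d)) +
                          4 * ((((2 * cth 32 1 sS + 1) ^ d : ℕ) : ℝ) * (5 : ℝ) ^ d)) / (1 - θc)) +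
                    ((max 1 (2 * 32 + 2) : ℕ) : ℝ) * (2 * ((((2 * cth 32 1 sS + 1) ^ d : ℕ) : ℝ) * (5 : ℝ) ^ d)) + 1) *
                  (1 + 4 * 2 ^ d)) + 1)) +
            10) + 8 * 2 ^ d * Real.log (2 * d + 1)
  -- THE INFRARED CLAUSE AT THE EXPLICIT THRESHOLD, from the window's first factor
  have hir : payThresholdRoot C F.L rr β₀ ≤ Real.log (g ^ 2)⁻¹ :=
    HistoryRealiseCellsRunPinned.le_log_inv_sq_of_le_exp hg ((hgle.trans (min_le_left _ _)).trans (min_le_right _ _))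
  intro ι _ α π _ _ l₀ vol K₀ T A A' shA shB dead dead' nup mup Nup Cc Rr CcRec RrRec ν u s₂ q₀ r s Wsh obs B hobs hbd
    hα hα' c₀ n₁ hc₀ hfloor hfloor' hsites hsites' hNup hnup hmup R hR hR1 ped cellP liveC Zd H hstep hDJ hBB κ κ' hκ hκ'
    FcM RfM FcM' RfM' hPM hPM' upM deadM_nonneg resumM FM_nonneg upM' deadM'_nonneg resumM' FM'_nonneg hSh hTB hr hu hs
    hs₂
  obtain ⟨hP1, hθJ, hP⟩ := HistoryFlowProfileRoot.thresholdPaid_of_coupling_root D h hA₀ hθ Θ hb.le hlo hhi hγ₀le hγβ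
    hSm hβhalf ht hg (hgle.trans (min_le_right _ _)) K₀
  -- the run's profile is stepwise non-increasing and drop-controlled (from the flow, as END v3.2′ derives it inside)
  have hprof : ∀ K, K₀ ≤ K → ∀ t, runProfile F.L R K (t + 1) ≤ runProfile F.L R K t := fun K _ t => by
    by_cases htK : t < K
    · exact runProfile_succ_le D hb.le hlo hhi hγ₀le hγβ hSm ht R hR K t htK
    · show expOf F.L (R K) (min (t + 1) K) ≤ expOf F.L (R K) (min t K)
      rw [min_eq_right (by omega), min_eq_right (by omega)]
  have hdropR : ∀ K, K₀ ≤ K → ∀ m, DropCtl (runProfile F.L R K) m := fun K _ =>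
    dropCtl_runProfile D hb.le hlo hhi hγ₀le hγβ hSm (le_max_right _ _) hβhalf ht R hR K
  -- the fatness cap of the members' births (as in `…MultEndPTwin` ∕ `…MultEndPDTwin`)
  have hMf : ∀ K, K₀ ≤ K → ∀ τ ∈ T K, ∀ c ∈ liveC K τ, ∀ bz ∈ ((ped K τ).toPGen (cellP K τ) c).pbirths,
      tcap d bz.1.fat ≤ (fun K => tcap d (dcapOf Prod.fst T (memOf ped liveC (cellOfR n F.L (runProfile F.L R) ped cellP)) K)) K :=
    fun K hK τ hτ c hc bz hbz => tcap_mono d (le_of_lt (fat_lt_dcapOf_of_mem_pbirths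
      (fun K hK τ hτ => H.renew_step K hK τ hτ) (cellOfR n F.L (runProfile F.L R) ped cellP) hK hτ hc hbz))
  -- file 2's multiplicity socket AT THE EXPLICIT THRESHOLD, the slot multiplicity supplied by leaf-08 gen 11's
  -- `card_koccOf_le_exp_of_twin` over (a) `hdis` DISCHARGED from `DisjointJoins` ∕ `BoxedBirths` (`hdisV_of_domainsR`,
  -- exactly as END v3.1′ ∕ `…MultEndPDTwin`) and (b) the twin bound PRODUCED by leaf-05 gen 10's `htwin_concave`
  exact hybridNE7_of_realisedDomainsRun_printedMultPPayRoot D h hμ d n hκ₁ hE₀ hb.le hlo hhi hγ₀le hγβ hSm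
    (le_max_left _ _) (le_max_right _ _) hβhalf ht hir hP1 hP hsign hcor (hγle.trans (min_le_right _ _)) hobs hbd hα
    hα' hc₀ hfloor hfloor' hsites hsites' hNup hnup hmup R hR (HistoryRealiseCellsRunPinned.four_le_L F) hn₁ hR1 ped
    cellP liveC Zd H hn
    (physV n F.L hn (Nat.lt_of_lt_of_le Nat.zero_lt_two (two_le_L F))
        (fun K => tcap d (dcapOf Prod.fst T (memOf ped liveC (cellOfR n F.L (runProfile F.L R) ped cellP)) K))
        (fun K => one_le_tcap d (dcapOf Prod.fst T (memOf ped liveC (cellOfR n F.L (runProfile F.L R) ped cellP)) K)) (runProfile F.L R) ped cellP)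
    hθ.le hslack (Λm := (F.L : ℝ) ^ d) (Λr := 1) (by positivity) zero_le_one (by rw [mul_one]) κ κ' hκ hκ'
    (fun K q => (8 / C.E₂ * totalCostT Prod.fst C K (R K) q.2 + 4 * (partnerAges (PEv.step ∘ Prod.fst) q.2 : ℝ)))
    (fun K hK τ hτ c hc => card_koccOf_le_exp_of_twin hn (Nat.lt_of_lt_of_le Nat.zero_lt_two (two_le_L F))
      (HistoryRealiseCellsRunPinned.four_le_L F) hn₁
      (fun K => one_le_tcap d (dcapOf Prod.fst T (memOf ped liveC (cellOfR n F.L (runProfile F.L R) ped cellP)) K)) hprof hdropR hR1 H hstep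
      hMf jhalf
      (fun K hK τ hτ c hc => hdisV_of_domainsR (Nat.lt_of_lt_of_le Nat.zero_lt_two (two_le_L F)) hn
        (fun K => one_le_tcap d (dcapOf Prod.fst T (memOf ped liveC (cellOfR n F.L (runProfile F.L R) ped cellP)) K))
        (fun K hK t _ => hprof K hK t) (fun K hK => hdropR K hK K) H hDJ hBB hMf hK (mem_badTerms.1 hτ).1 hc)
      (fun K hK τ hτ c hc hcons hKs Mz Dz c₀ ρ z =>
        htwin_concave hn (Nat.lt_of_lt_of_le Nat.zero_lt_two (two_le_L F)) hE₂ hE₃ hprof hdropR hR1 H hsS hsmall hθc0 hθc1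
          hθcs K hK τ hτ c hc hcons hKs Mz Dz c₀ ρ z)
      hθJ hK hτ hc)
    hPM hPM' upM deadM_nonneg resumM FM_nonneg upM' deadM'_nonneg resumM' FM'_nonneg hSh hTB hr hu hs hs₂

/-! ## §2 What binds the displayed first factor, BY NAME (the census number's shape; numbers journal-only, c6) -/

/-- (F1) Under the displayed window the coupling sits below the MERGER-CLAUSE factor `e^{−x₄∕2}`, `x₄` the fourth root
clause of `payThresholdRoot` (p232877 §4 `exp_neg_payThresholdRoot_half_le_merger`). [folklore] -/
example {C : T4PrintedShapeBanking.Consts} {rr : ℕ} {β₀ g X : ℝ}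
    (hgle : g ≤ min (min 1 (Real.exp (-(payThresholdRoot C F.L rr β₀) / 2))) X) :
    g ≤ Real.exp (-(rootClause ((F.L : ℝ) ^ (C.q' + 1) * (1 + β₀) *
        ((1 + C.n₁) * C.E₂ * (F.L : ℝ) ^ C.q' + C.dC * C.E₃ * (F.L : ℝ) ^ C.q')) (1 / (1 + β₀) * C.A₀)
      (C.p₀ - rr * (C.q' + 1))) / 2) :=
  ((hgle.trans (min_le_left _ _)).trans (min_le_right _ _)).trans
    (exp_neg_payThresholdRoot_half_le_merger C F.L rr β₀)

/-- (F2) … and below `e^{−1∕2}` (`one_le_payThresholdRoot`): on the explicit road the first factor is a genuine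
smallness condition whatever the constants. [folklore] -/
example {C : T4PrintedShapeBanking.Consts} {rr : ℕ} {β₀ g X : ℝ}
    (hgle : g ≤ min (min 1 (Real.exp (-(payThresholdRoot C F.L rr β₀) / 2))) X) :
    g ≤ Real.exp (-(1 : ℝ) / 2) := by
  refine ((hgle.trans (min_le_left _ _)).trans (min_le_right _ _)).trans (Real.exp_le_exp.2 ?_)
  have h1 := one_le_payThresholdRoot C F.L rr β₀
  linarith

end Pinned

end

end Summit.QuantumFields.BalabanUV.T4Continuum.HistoryRealiseCellsRunWindowT3bPcPayRoot
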